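import Summits.ABC.IUTFork.Repair.RHAvgSlackNonneg
import Summits.ABC.IUTFork.Cor312ProvKRamified
import HarnessLib

/-!
# D-0079 RESCUE sub-cell R-H, ROUND 1, ROW 11 «avg-slack-nonneg» — the TESTER's k2/k3 lemmas (pair n = 11, abc-iut-rh-tst-11)
# H⋆₁₁ = `RHAvgSlackNonneg.HStarMinus` (abc-iut-rh-typ-11, p457626) against the UNRAMIFIED-ODD refutation family, in the kernel

PROOF-ONLY companion (0 `def`, no `Prop` fact; own sub-namespace `Summit.ABC.IUTFork.Repair.RHAvgSlackNonneg.UnramOdd`) of abc-iut-rh-typ-11's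
deciding decl `Summits/ABC/IUTFork/Repair/RHAvgSlackNonneg.lean` (p457626 ✓). abc-iut cell, rung LADDER-ABC:A2.RESCUE.H; director-abc
2026-08-26T15:32:46Z (D-0107) R-H ROUND 1, tester k2 «does H⋆ₙ survive the unramified-odd refutation family that killed I06⋆ as typed».
TAKES NO SIDE on [IUTchIII] Cor. 3.12 or on any author; H⋆₁₁ is a HYPOTHESIS (claim-tagged def of p457626), never asserted here; typed ≠ proved;
refuted-as-typed ≠ refuted-in-print.

THE FAMILY, BY NAME (all landed): abc-iut-rp-d2 `CandInternal2Real.not_mem_jsq_smul_logShell_of_unramified` (p432650; `K_w/ℚ_p` UNRAMIFIED, `p ≠ 2`: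
`q ∉ q^{j²}·𝓘_{K_w}` for `j ≥ 2`, because `𝓘_{K_w} = 𝒪_{K_w}` — ZERO shell capacity), abc-iut-rp-cx `EvalHonestCeiling.i06_false_of_honest`,
abc-iut-w5-d204 `Cor312Vol.LicenceSharpDegreeOne.not_pilotKummerCompatHull_settingPrVolSharp_rat_of_qPinned` (R-W row S-RAT «REFUTED-concrete»), the price law
abc-iut-rp-m4 `CandInternal2NoGo.star_iff_price` / `no_uniform_index`. Every member lives at an UNRAMIFIED bad place over an odd prime (`e_w = 1`).

WHAT THIS FILE PROVES (integer shadows in the column vocabulary of p457626, then the genuine `K`-level statement):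
* §1 `capMinusW_one` / `capPlusW_one`: at `e_w = 1` over an odd prime BOTH shell capacities of the table are ZERO (`κ⁻ = κ⁺ = 0`) — the column form of
  `𝓘_{K_w} = 𝒪_{K_w}` (`CandInternal2Real.logShell_ofUnitLog_eq_closedBall_of_unramified`).
* §2 `placeSumMinus_one_neg` / `placeSumPlus_one_neg`: hence the label sums of BOTH forms of H⋆₁₁ are `< 0` at every such place as soon as
  `ord_w(q) ≥ 1` and `l ≥ 5` — H⋆₁₁'s recipe is NEGATIVE on the whole unramified-odd stratum, i.e. it FAILS there exactly as I06⋆ does (bin (B) of the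
  tester's pre-registered protocol: NEG-consistent — the target is itself kernel-refuted there, law (L2) of plan/rescue/R-H/START-HERE.md §3);
  `placeSum_srat`: the stratum's row of record S-RAT (`p = 7`, `e_w = 1`, `ord_w(q) = 1`, `l = 5`) has both label sums `= −3`.
* §3 `l_le_ramIdx_of_mem_S` / `ramIdx_ne_one_of_mem_S`: at the GENUINE `K`-level datum `pilotDataOfK D K` over which `HStarMinus D` is typed, EVERY bad
  place has `e_w ≥ l ≥ 5` (abc-iut-w5-d054 `Cor312Prov.l_le_ramificationIdx_int_of_over_VFbad`, [IUTchI] Ex. 3.2 (iv) read backwards): the family's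
  hypothesis `e_w = 1` is NOT INSTANTIABLE inside the binder of `HStarMinus D` (bin (C): scope-excluded by the decl's own currency). So no landed
  Negative lemma of the family meets H⋆₁₁ as typed; the collision exists only at the column level (§2), where H⋆₁₁ is negative anyway.
* §4 `capMinusW_le_capPlusW` / `hStarPlus_of_hStarMinus'`: `κ⁻ ≤ κ⁺` at every `(p, e)` with `p ≥ 2`, `e ≥ 1`, hence A⁻ ⟹ A⁺ UNCONDITIONALLY at every
  genuine datum — H⋆₁₁ is never positive where the NECESSARY averaged column (`HStarPlus`, implied by the typed Statement inside the containers reading,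
  `RHAvgSlackNonneg.avgIndexSlackNonneg_of_statement`) is negative: the «window compatibility» (tester k3) of a Statement-level candidate BY CONSTRUCTION.
HONEST SCOPE: integer arithmetic and one ramification fact; nothing here decides a genuine cell; the verdict words (KILL/KEEP) are the desk's, not the
file's. [cite: Mochizuki2012, IUTchI Def. 3.1 (b)(c) p. 61, Ex. 3.2 (iv) p. 71; IUTchIV Prop. 1.2 (i) p. 10] [cite: NeukirchANT1999, Ch. II (8.5)]
[claim: Mochizuki2012, status: disputed] for every IUT locution. Axioms: standard.
-/

noncomputable section

open Set Function NumberField IsDedekindDomain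

namespace Summit.ABC.IUTFork.Repair.RHAvgSlackNonneg.UnramOdd

open Thm311 Cor312 Cor312Vol Cor312Prov Literature.IUT.LogThetaLattice Literature.IUT.LogVolume Literature.IUT.HodgeTheaters
  Summit.ABC.IUTFork.Repair.RHAvgSlackNonneg

/-! ## §1. Zero shell capacity at an unramified place over an odd prime (`e_w = 1`, `p > 2`): `κ⁻ = κ⁺ = 0` -/

/-- `e·a_e = 1` at `e = 1`, `p > 2` (`⌈1/(p−2)⌉ = 1`). [cite: Mochizuki2012, IUTchIV Prop. 1.2 (i) p. 10] -/
theorem eMulA_one {p : ℕ} (hp : 2 < p) : eMulA p 1 = 1 := by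
  unfold eMulA
  rw [if_neg (by omega)]
  have h : 1 + p - 3 = p - 2 := by omega
  rw [h]
  exact Nat.div_self (by omega)

/-- `⌊log_p(p/(p−1))⌋ = 0` at `e = 1`, `p > 2` (`p/(p−1) = 1` in `ℕ`). [cite: Mochizuki2012, IUTchIV Prop. 1.2 (i) p. 10] -/
theorem eFloorLog_one {p : ℕ} (hp : 2 < p) : eFloorLog p 1 = 0 := by
  unfold eFloorLog
  have h : p * 1 / (p - 1) = 1 := by
    rw [mul_one]
    refine Nat.div_eq_of_lt_le (by omega) (by omega)
  rw [h, Nat.log_one_right]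

/-- **SUFFICIENT capacity ZERO at `e_w = 1` over an odd prime**: `e·κ⁻ = c − a_1 = 1 − 1 = 0` — the column shadow of `𝓘_{K_w} = 𝒪_{K_w}`
(abc-iut-rp-d2 `CandInternal2Real.logShell_ofUnitLog_eq_closedBall_of_unramified`). [cite: Mochizuki2012, IUTchIV Prop. 1.2 (i) p. 10] -/
theorem capMinusW_one {p : ℕ} (hp : 2 < p) : capMinusW p 1 = 0 := by
  unfold capMinusW cExp
  rw [eMulA_one hp, if_neg (by omega)]
  simp

/-- **NECESSARY capacity ZERO at `e_w = 1` over an odd prime**: `e·κ⁺ = c + ⌊log_p(p/(p−1))⌋ − 1 = 0`. [cite: Mochizuki2012, IUTchIV Prop. 1.2 (i) p. 10] -/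
theorem capPlusW_one {p : ℕ} (hp : 2 < p) : capPlusW p 1 = 0 := by
  unfold capPlusW cExp
  rw [eFloorLog_one hp, if_neg (by omega)]
  simp

/-! ## §2. H⋆₁₁'s recipe is NEGATIVE at every unramified-odd place (both forms), and the S-RAT row of record -/

/-- At `e_w = 1`, `p > 2` the sufficient cell slack at label `j = i + 1` is `−((i+1)² − 1)·ord_w(q)`. [cite: Mochizuki2012, IUTchIV Prop. 1.2 (i) p. 10] -/
theorem slackMinusW2l_one {p : ℕ} (hp : 2 < p) (ordq : ℤ) (l j : ℕ) :
    slackMinusW2l p 1 ordq l j = -(((j : ℤ) ^ 2 - 1) * ordq) := by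
  unfold slackMinusW2l
  rw [capMinusW_one hp]
  ring

/-- At `e_w = 1`, `p > 2` the necessary cell slack at label `j` is `−((j)² − 1)·ord_w(q)` as well. [cite: Mochizuki2012, IUTchIV Prop. 1.2 (i) p. 10] -/
theorem slackPlusW2l_one {p : ℕ} (hp : 2 < p) (ordq : ℤ) (l j : ℕ) :
    slackPlusW2l p 1 ordq l j = -(((j : ℤ) ^ 2 - 1) * ordq) := by
  unfold slackPlusW2l
  rw [capPlusW_one hp]
  ring

/-- **H⋆₁₁ (A⁻ form) is NEGATIVE at every unramified place over an odd prime** with `ord_w(q) ≥ 1` and `l ≥ 5`: `placeSumMinus p 1 ord_w(q) l < 0`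
(every label term is `≤ 0`, the `j = 2` term is `−3·ord_w(q) < 0`). The recipe thus FAILS on the unramified-odd stratum exactly as I06⋆ does
(`CandInternal2Real.not_mem_jsq_smul_logShell_of_unramified`) — and exactly where the hull clause is kernel-refuted (R-W row S-RAT,
`LicenceSharpDegreeOne.not_pilotKummerCompatHull_settingPrVolSharp_rat_of_qPinned`): NEG-consistent, law (L2). [claim: Mochizuki2012, status: disputed] -/
theorem placeSumMinus_one_neg {p : ℕ} (hp : 2 < p) {ordq : ℤ} (hq : 0 < ordq) {l : ℕ} (hl : 5 ≤ l) :
    placeSumMinus p 1 ordq l < 0 := by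
  unfold placeSumMinus
  simp only [slackMinusW2l_one hp]
  have hmem : 1 ∈ Finset.range ((l - 1) / 2) := Finset.mem_range.mpr (by omega)
  have hle : ∀ i ∈ Finset.range ((l - 1) / 2), -((((i + 1 : ℕ) : ℤ) ^ 2 - 1) * ordq) ≤ 0 := by
    intro i _
    have h1 : (0 : ℤ) ≤ ((i + 1 : ℕ) : ℤ) ^ 2 - 1 := by
      have : (1 : ℤ) ≤ ((i + 1 : ℕ) : ℤ) := by exact_mod_cast Nat.succ_le_succ (Nat.zero_le i)
      nlinarith
    nlinarith
  have hlt : -((((1 + 1 : ℕ) : ℤ) ^ 2 - 1) * ordq) < 0 := by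
    push_cast
    nlinarith
  calc ∑ i ∈ Finset.range ((l - 1) / 2), -((((i + 1 : ℕ) : ℤ) ^ 2 - 1) * ordq)
      < ∑ i ∈ Finset.range ((l - 1) / 2), (0 : ℤ) := Finset.sum_lt_sum hle ⟨1, hmem, hlt⟩
    _ = 0 := Finset.sum_const_zero

/-- **The A⁺ (necessary) form is NEGATIVE there too** (`κ⁺ = 0` as well): `placeSumPlus p 1 ord_w(q) l < 0`. [claim: Mochizuki2012, status: disputed] -/
theorem placeSumPlus_one_neg {p : ℕ} (hp : 2 < p) {ordq : ℤ} (hq : 0 < ordq) {l : ℕ} (hl : 5 ≤ l) :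
    placeSumPlus p 1 ordq l < 0 := by
  have h : placeSumPlus p 1 ordq l = placeSumMinus p 1 ordq l := by
    unfold placeSumPlus placeSumMinus
    exact Finset.sum_congr rfl fun i _ => by rw [slackPlusW2l_one hp, slackMinusW2l_one hp]
  rw [h]
  exact placeSumMinus_one_neg hp hq hl

/-- **S-RAT, the unramified-odd row of record** (I06STAR-COLUMNS `concrete:Cor312LicenceSharpRat`, R-W WINDOW-TABLE v1 row S-RAT «REFUTED-concrete
(kernel)»: `p = 7`, `e_w = f_w = 1`, `H = ord_w(q) = 1`, `l = 5`): both label sums equal `−3 < 0` (`= 2l·e_w·l⋆ ×` the table's averaged slack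
`−3/10`). [claim: Mochizuki2012, status: disputed] -/
theorem placeSum_srat : placeSumMinus 7 1 1 5 = -3 ∧ placeSumPlus 7 1 1 5 = -3 := by
  unfold placeSumMinus placeSumPlus slackMinusW2l slackPlusW2l capMinusW capPlusW eMulA eFloorLog cExp
  exact ⟨by decide, by decide⟩

/-! ## §3. At the genuine `K`-level datum the family's hypothesis `e_w = 1` is not instantiable (`e_w ≥ l ≥ 5` at every bad place) -/

section Genuine

variable {F K Fbar : Type} [Field F] [NumberField F] [Field K] [NumberField K] [Algebra F K] [Field Fbar]
  [Algebra F Fbar] [Algebra K Fbar] {E : WeierstrassCurve F} [E.IsElliptic] {l : ℕ} {Pb : BadPlacePredicates K}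
  (D : InitialThetaData F K Fbar E l Pb)

/-- **`l ≤ e_w` at every bad place of `pilotDataOfK D K`** (`K = F(E_F[l])`; `2l ∣ ord_w(q) = e(w|v)·ord_v(q_v)` with `l ∤ ord_v(q_v)` forces
`l ∣ e(w|v)`; abc-iut-w5-d054 `Cor312Prov.l_le_ramificationIdx_int_of_over_VFbad`, restated on the `ramIdx` column that `HStarMinus` reads).
[cite: Mochizuki2012, IUTchI Def. 3.1 (c) p. 61, Ex. 3.2 (iv) p. 71] [cite: NeukirchANT1999, Ch. II (8.5)] [claim: Mochizuki2012, status: disputed] -/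
theorem l_le_ramIdx_of_mem_S {w : HeightOneSpectrum (𝓞 K)} (hS : w ∈ (pilotDataOfK D K).S) : l ≤ ramIdx K w := by
  rw [ramIdx_eq K w]
  exact l_le_ramificationIdx_int_of_over_VFbad D w ((mem_pilotDataOfK_S_iff D K w).mp hS)

/-- Hence `5 ≤ e_w` at every bad place of the genuine datum. [cite: Mochizuki2012, IUTchI Def. 3.1 (c) p. 61] [claim: Mochizuki2012, status: disputed] -/
theorem five_le_ramIdx_of_mem_S {w : HeightOneSpectrum (𝓞 K)} (hS : w ∈ (pilotDataOfK D K).S) : 5 ≤ ramIdx K w :=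
  D.five_le_l.trans (l_le_ramIdx_of_mem_S D hS)

/-- **No bad place of the genuine datum is unramified**: `e_w ≠ 1` on the support of `HStarMinus D` — the unramified-odd family's hypothesis
(`e(K_w/ℚ_p) = 1`, `CandInternal2Real.not_mem_jsq_smul_logShell_of_unramified`; «`F = ℚ`, every bad place of local degree one»,
`LicenceSharpDegreeOne.not_pilotKummerCompatHull_settingPrVolSharp_rat_of_qPinned`) cannot be met by any summand of H⋆₁₁ as typed: the supports are
DISJOINT (bin (C) of the tester protocol). [cite: Mochizuki2012, IUTchI Ex. 3.2 (iv) p. 71] [claim: Mochizuki2012, status: disputed] -/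
theorem ramIdx_ne_one_of_mem_S {w : HeightOneSpectrum (𝓞 K)} (hS : w ∈ (pilotDataOfK D K).S) : ramIdx K w ≠ 1 := by
  have h := five_le_ramIdx_of_mem_S D hS
  omega

/-! ## §4. A⁻ ⟹ A⁺ unconditionally at the genuine datum (tester k3 «window compatibility» by construction) -/

/-- `1 ≤ e·a_e` whenever `e ≥ 1` and `p ≥ 2` (`⌈e/(p−2)⌉ ≥ 1`, and `2e ≥ 2` at `p = 2`). [cite: Mochizuki2012, IUTchIV Prop. 1.2 (i) p. 10] -/
theorem one_le_eMulA {p e : ℕ} (hp : 2 ≤ p) (he : 1 ≤ e) : 1 ≤ eMulA p e := by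
  unfold eMulA
  by_cases h2 : p = 2
  · rw [if_pos h2]; omega
  · rw [if_neg h2]
    exact (Nat.le_div_iff_mul_le (by omega)).mpr (by omega)

/-- **`κ⁻ ≤ κ⁺` in `w`-units**: `capMinusW p e ≤ capPlusW p e` for `p ≥ 2`, `e ≥ 1` (`a_e + b_e ≥ 0`: `e·a_e ≥ 1 ≥ 1 − e·⌊log_p(pe/(p−1))⌋`).
[cite: Mochizuki2012, IUTchIV Prop. 1.2 (i) p. 10] -/
theorem capMinusW_le_capPlusW {p e : ℕ} (hp : 2 ≤ p) (he : 1 ≤ e) : capMinusW p e ≤ capPlusW p e := by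
  unfold capMinusW capPlusW
  have h1 : (1 : ℤ) ≤ ((eMulA p e : ℕ) : ℤ) := by exact_mod_cast one_le_eMulA hp he
  have h2 : (0 : ℤ) ≤ ((e * eFloorLog p e : ℕ) : ℤ) := by positivity
  omega

/-- **A⁻ ⟹ A⁺ at EVERY genuine datum, with no side condition** (`p_w ≥ 2` is a prime, `e_w ≥ l ≥ 5 ≥ 1` by §3): `HStarMinus D → HStarPlus D`
(abc-iut-rh-typ-11 `hStarPlus_of_hStarMinus` with its capacity hypothesis discharged). So H⋆₁₁ is never positive at a datum where the NECESSARY averaged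
column is negative — the Statement-level form of law (L2) holds by construction. [claim: Mochizuki2012, status: disputed] -/
theorem hStarPlus_of_hStarMinus' (h : HStarMinus D) : HStarPlus D :=
  hStarPlus_of_hStarMinus D
    (fun w hw => capMinusW_le_capPlusW (residueChar_prime K w).two_le
      (le_trans (by norm_num) (five_le_ramIdx_of_mem_S D hw))) h

/-- Contrapositive, the form the table reads: **`¬ HStarPlus D → ¬ HStarMinus D`** — every datum on which the necessary column A⁺ fails (e.g. all
`lamSeven` rows with `k ≥ 3`, `concrete:DH11a1`) fails H⋆₁₁ a fortiori. [claim: Mochizuki2012, status: disputed] -/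
theorem not_hStarMinus_of_not_hStarPlus (h : ¬ HStarPlus D) : ¬ HStarMinus D :=
  fun hm => h (hStarPlus_of_hStarMinus' D hm)

end Genuine

end Summit.ABC.IUTFork.Repair.RHAvgSlackNonneg.UnramOdd

end
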